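import Mathlib
import Summits.Ventures.HodgeRepro.Tier4.Target
import Summits.Ventures.HodgeRepro.Tier4.Line3.DatumOrthVanishing
import Summits.Ventures.HodgeRepro.Tier4.Line3.SlotFunctionAlgebra

/-!
# Tier4/Line3/ModelIntegrand — the shape integrand, the model integrand, dilation and translation on `ℂ²`

Blind re-derivation cell `pub-hodge-repro`, Tier 4 «PROVE THE STEP» (README §9–§10), LINE L3, seat t4-L3-p1 (gen 3),
self-cut C-L3-DILCOMP (bus S14565), module 2 of 5.

* `shapeInt y₀ y₁ W α β z = ‖f₀‖² ‖f₁‖² / g⁴ · ‖W z‖² · e^{−π(α · 2‖f₀‖²/g + β · 2‖f₁‖²/g)}` (`f_j = w_z^* J y_j`,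
  `g = 1 − nsq z`): the two-parameter integrand `dilInt` of a datum whose Gaussian-free part has the Kudla–Millson shape,
  up to the scalar `|c|⁴`; non-negative, antitone in `(α, β)` on the ball (`shapeInt_anti`);
* `modelInt y₀ y₁ c w = ‖ℓ₀ w‖² ‖ℓ₁ w‖² e^{−c(‖ℓ₀ w‖² + ‖ℓ₁ w‖²)}`, the shape integrand frozen at the common zero;
  homogeneous: `modelInt c (R • w) = R⁴ modelInt (c R²) w`;
* two generic identities on `ℂ² = Fin 2 → ℂ` (sup-norm balls, Lebesgue measure): translation
  (`setIntegral_ball_translate`) and dilation `∫_{B(0,r)} F (R • w) dw = R⁻⁴ ∫_{B(0,Rr)} F` (`setIntegral_ball_comp_smul`,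
  from `Measure.integral_comp_smul` with `finrank ℝ ℂ² = 4`); hence `∫_{B(0,r)} modelInt (cs) = s⁻⁴ ∫_{B(0,√s r)} modelInt c`
  and the same on `ℂ²` (`setIntegral_modelInt_ball`, `integral_modelInt`);
* the model integrand is continuous, Gaussian-dominated (`modelInt c ≤ (2/c²) e^{−cσ² S/2}`, `σ² = ‖Δ‖²/(4N)`,
  `S = ‖w₀‖² + ‖w₁‖²`: `modelInt_le_gauss`), hence integrable on `ℂ²` (`integrable_modelInt`, from
  `GaussianFourier.integrable_cexp_neg_mul_sq_norm_add` on `ℂ` and `Integrable.fintype_prod`), and its integral over every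
  ball `B(0, r)`, `r > 0`, is positive (`setIntegral_modelInt_pos`: the integrand is positive near the point
  `t • b₀` where both linear forms equal `t`).

Imports: Mathlib, `Tier4/Target`, `Line3/DatumOrthVanishing`, `Line3/SlotFunctionAlgebra` by name.  `#print axioms` of
every theorem = `[propext, Classical.choice, Quot.sound]`.  No printed input is consumed.  Nothing here asserts anything about the truth of (P); HC_CM is NOT proved by anyone in this repository.
-/

set_option autoImplicit false

noncomputable section

namespace Summit.Ventures.HodgeRepro.Tier4.Line3

open Summit.Ventures.HodgeRepro.Tier4
open Matrix MeasureTheory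
open scoped ComplexConjugate

/-! ## 3. The shape integrand and the model integrand -/

/-- **THE SHAPE INTEGRAND** `Q(z) g(z)^{-4} ‖W z‖² e^{−π(α m₀(z) + β m₁(z))}` with `Q = ‖f₀‖² ‖f₁‖²`, `g = 1 − nsq z`,
`m_j = 2 ‖f_j‖² / g`, `f_j(z) = w_z^* J y_j` — the two-parameter integrand `dilInt` of a datum whose Gaussian-free part
has the Kudla–Millson shape, up to the scalar `|c|⁴`. -/
def shapeInt (y₀ y₁ : Fin 3 → ℂ) (W : (Fin 2 → ℂ) → ℂ) (α β : ℝ) (z : Fin 2 → ℂ) : ℝ :=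
  ‖star (lift3 z) ⬝ᵥ (J *ᵥ y₀)‖ ^ 2 * ‖star (lift3 z) ⬝ᵥ (J *ᵥ y₁)‖ ^ 2 / (1 - nsq z) ^ 4 * ‖W z‖ ^ 2 *
    Real.exp (-(Real.pi * (α * (2 * ‖star (lift3 z) ⬝ᵥ (J *ᵥ y₀)‖ ^ 2 / (1 - nsq z)) +
      β * (2 * ‖star (lift3 z) ⬝ᵥ (J *ᵥ y₁)‖ ^ 2 / (1 - nsq z)))))

/-- **THE MODEL INTEGRAND** on `ℂ²`: `‖ℓ₀(w)‖² ‖ℓ₁(w)‖² e^{−c (‖ℓ₀(w)‖² + ‖ℓ₁(w)‖²)}` (the shape integrand at the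
common zero, frozen coefficients). -/
def modelInt (y₀ y₁ : Fin 3 → ℂ) (c : ℝ) (w : Fin 2 → ℂ) : ℝ :=
  ‖slotLin y₀ w‖ ^ 2 * ‖slotLin y₁ w‖ ^ 2 *
    Real.exp (-(c * (‖slotLin y₀ w‖ ^ 2 + ‖slotLin y₁ w‖ ^ 2)))

/-- The shape integrand is non-negative. -/
theorem shapeInt_nonneg (y₀ y₁ : Fin 3 → ℂ) (W : (Fin 2 → ℂ) → ℂ) (α β : ℝ) (z : Fin 2 → ℂ) :
    0 ≤ shapeInt y₀ y₁ W α β z := by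
  unfold shapeInt; positivity

/-- The model integrand is non-negative. -/
theorem modelInt_nonneg (y₀ y₁ : Fin 3 → ℂ) (c : ℝ) (w : Fin 2 → ℂ) : 0 ≤ modelInt y₀ y₁ c w := by
  unfold modelInt; positivity

/-- Monotonicity in the parameters on the ball: a larger exponent gives a smaller integrand. -/
theorem shapeInt_anti (y₀ y₁ : Fin 3 → ℂ) (W : (Fin 2 → ℂ) → ℂ) {α β α' β' : ℝ} (hα : α ≤ α') (hβ : β ≤ β')
    {z : Fin 2 → ℂ} (hz : z ∈ ball) : shapeInt y₀ y₁ W α' β' z ≤ shapeInt y₀ y₁ W α β z := by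
  unfold shapeInt
  have hg : 0 < 1 - nsq z := by have := hz; simp only [ball, Set.mem_setOf_eq] at this; linarith
  refine mul_le_mul_of_nonneg_left (Real.exp_le_exp.2 ?_) (by positivity)
  have h0 : 0 ≤ 2 * ‖star (lift3 z) ⬝ᵥ (J *ᵥ y₀)‖ ^ 2 / (1 - nsq z) := by positivity
  have h1 : 0 ≤ 2 * ‖star (lift3 z) ⬝ᵥ (J *ᵥ y₁)‖ ^ 2 / (1 - nsq z) := by positivity
  nlinarith [Real.pi_pos, mul_le_mul_of_nonneg_right hα h0, mul_le_mul_of_nonneg_right hβ h1]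

/-- The model integrand under a real dilation: `modelInt c (R • w) = R⁴ · modelInt (c R²) w`. -/
theorem modelInt_real_smul (y₀ y₁ : Fin 3 → ℂ) (c R : ℝ) (w : Fin 2 → ℂ) :
    modelInt y₀ y₁ c (R • w) = R ^ 4 * modelInt y₀ y₁ (c * R ^ 2) w := by
  unfold modelInt
  rw [slotLin_real_smul, slotLin_real_smul, norm_mul, norm_mul, Complex.norm_real, Real.norm_eq_abs,
    mul_pow, mul_pow, sq_abs]
  have he : Real.exp (-(c * (R ^ 2 * ‖slotLin y₀ w‖ ^ 2 + R ^ 2 * ‖slotLin y₁ w‖ ^ 2))) =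
      Real.exp (-(c * R ^ 2 * (‖slotLin y₀ w‖ ^ 2 + ‖slotLin y₁ w‖ ^ 2))) := by
    congr 1; ring
  rw [he]
  ring

/-! ## 4. Two generic integral identities on `ℂ² = Fin 2 → ℂ`: translation and dilation of a sup-norm ball -/

/-- Translation of a set integral over a sup-norm ball. -/
theorem setIntegral_ball_translate (F : (Fin 2 → ℂ) → ℝ) (zs : Fin 2 → ℂ) (r : ℝ) :
    ∫ z in Metric.ball zs r, F z = ∫ w in Metric.ball (0 : Fin 2 → ℂ) r, F (w + zs) := by
  rw [← integral_indicator Metric.isOpen_ball.measurableSet, ← integral_indicator Metric.isOpen_ball.measurableSet,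
    ← integral_add_right_eq_self (fun z => (Metric.ball zs r).indicator F z) zs]
  congr 1
  ext w
  have hiff : w + zs ∈ Metric.ball zs r ↔ w ∈ Metric.ball (0 : Fin 2 → ℂ) r := by
    rw [Metric.mem_ball, Metric.mem_ball, dist_eq_norm, dist_eq_norm, add_sub_cancel_right, sub_zero]
  by_cases hw : w ∈ Metric.ball (0 : Fin 2 → ℂ) r
  · rw [Set.indicator_of_mem (hiff.2 hw), Set.indicator_of_mem hw]
  · rw [Set.indicator_of_notMem (fun h => hw (hiff.1 h)), Set.indicator_of_notMem hw]

/-- `Module.finrank ℝ (Fin 2 → ℂ) = 4`. -/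
theorem finrank_real_fin_two_complex : Module.finrank ℝ (Fin 2 → ℂ) = 4 := by
  simp [Module.finrank_pi_fintype]

/-- Dilation of a set integral over a sup-norm ball centred at `0`: `∫_{B(0,r)} F (R • w) dw = R^{-4} ∫_{B(0, R r)} F`. -/
theorem setIntegral_ball_comp_smul (F : (Fin 2 → ℂ) → ℝ) {R : ℝ} (hR : 0 < R) (r : ℝ) :
    ∫ w in Metric.ball (0 : Fin 2 → ℂ) r, F (R • w) =
      (R ^ 4)⁻¹ * ∫ v in Metric.ball (0 : Fin 2 → ℂ) (R * r), F v := by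
  rw [← integral_indicator Metric.isOpen_ball.measurableSet, ← integral_indicator Metric.isOpen_ball.measurableSet]
  have h := Measure.integral_comp_smul (volume : Measure (Fin 2 → ℂ)) ((Metric.ball (0 : Fin 2 → ℂ) (R * r)).indicator F) R
  rw [finrank_real_fin_two_complex, smul_eq_mul, abs_of_pos (inv_pos.2 (pow_pos hR 4))] at h
  rw [← h]
  congr 1
  ext w
  have hiff : R • w ∈ Metric.ball (0 : Fin 2 → ℂ) (R * r) ↔ w ∈ Metric.ball (0 : Fin 2 → ℂ) r := by
    rw [mem_ball_zero_iff, mem_ball_zero_iff, norm_smul, Real.norm_eq_abs, abs_of_pos hR]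
    exact ⟨fun h' => lt_of_mul_lt_mul_left h' hR.le, fun h' => mul_lt_mul_of_pos_left h' hR⟩
  by_cases hw : w ∈ Metric.ball (0 : Fin 2 → ℂ) r
  · rw [Set.indicator_of_mem (hiff.2 hw), Set.indicator_of_mem hw]
  · rw [Set.indicator_of_notMem (fun h => hw (hiff.1 h)), Set.indicator_of_notMem hw]

/-- Dilation of an integral over the whole space. -/
theorem integral_comp_smul_four (F : (Fin 2 → ℂ) → ℝ) {R : ℝ} (hR : 0 < R) :
    ∫ w, F (R • w) = (R ^ 4)⁻¹ * ∫ v, F v := by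
  have h := Measure.integral_comp_smul (volume : Measure (Fin 2 → ℂ)) F R
  rw [finrank_real_fin_two_complex, smul_eq_mul, abs_of_pos (inv_pos.2 (pow_pos hR 4))] at h
  exact h

/-- The model integral over `B(0, r)` at parameter `c s` is `s^{-4}` times the one at parameter `c` over `B(0, √s r)`. -/
theorem setIntegral_modelInt_ball (y₀ y₁ : Fin 3 → ℂ) (c : ℝ) {s : ℝ} (hs : 0 < s) (r : ℝ) :
    ∫ w in Metric.ball (0 : Fin 2 → ℂ) r, modelInt y₀ y₁ (c * s) w =
      (s ^ 4)⁻¹ * ∫ v in Metric.ball (0 : Fin 2 → ℂ) (Real.sqrt s * r), modelInt y₀ y₁ c v := by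
  have hR : 0 < Real.sqrt s := Real.sqrt_pos.2 hs
  have hsq : Real.sqrt s ^ 2 = s := Real.sq_sqrt hs.le
  have key : ∀ w, modelInt y₀ y₁ (c * s) w = (s ^ 2)⁻¹ * modelInt y₀ y₁ c (Real.sqrt s • w) := by
    intro w
    rw [modelInt_real_smul, hsq, show Real.sqrt s ^ 4 = s ^ 2 by rw [show (4:ℕ) = 2 * 2 by norm_num, pow_mul, hsq]]
    field_simp
  simp_rw [key]
  rw [integral_const_mul, setIntegral_ball_comp_smul _ hR,
    show Real.sqrt s ^ 4 = s ^ 2 by rw [show (4:ℕ) = 2 * 2 by norm_num, pow_mul, hsq]]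
  have hs2 : (s ^ 2)⁻¹ * (s ^ 2)⁻¹ = (s ^ 4)⁻¹ := by
    rw [← mul_inv, ← pow_add]
  rw [← mul_assoc, hs2]

/-- The model integral over `ℂ²` at parameter `c s` is `s^{-4}` times the one at parameter `c`. -/
theorem integral_modelInt (y₀ y₁ : Fin 3 → ℂ) (c : ℝ) {s : ℝ} (hs : 0 < s) :
    ∫ w, modelInt y₀ y₁ (c * s) w = (s ^ 4)⁻¹ * ∫ v, modelInt y₀ y₁ c v := by
  have hR : 0 < Real.sqrt s := Real.sqrt_pos.2 hs
  have hsq : Real.sqrt s ^ 2 = s := Real.sq_sqrt hs.le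
  have key : ∀ w, modelInt y₀ y₁ (c * s) w = (s ^ 2)⁻¹ * modelInt y₀ y₁ c (Real.sqrt s • w) := by
    intro w
    rw [modelInt_real_smul, hsq, show Real.sqrt s ^ 4 = s ^ 2 by rw [show (4:ℕ) = 2 * 2 by norm_num, pow_mul, hsq]]
    field_simp
  simp_rw [key]
  rw [integral_const_mul, integral_comp_smul_four _ hR,
    show Real.sqrt s ^ 4 = s ^ 2 by rw [show (4:ℕ) = 2 * 2 by norm_num, pow_mul, hsq]]
  have hs2 : (s ^ 2)⁻¹ * (s ^ 2)⁻¹ = (s ^ 4)⁻¹ := by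
    rw [← mul_inv, ← pow_add]
  rw [← mul_assoc, hs2]


/-! ## 5. The model integrand: continuous, Gaussian-dominated (hence integrable on `ℂ²`), positive integral on balls -/

/-- The linear part is continuous. -/
theorem continuous_slotLin (y : Fin 3 → ℂ) : Continuous (slotLin y) := by
  unfold slotLin
  exact ((Complex.continuous_conj.comp (continuous_apply 0)).mul continuous_const).add
    ((Complex.continuous_conj.comp (continuous_apply 1)).mul continuous_const)

/-- The model integrand is continuous on `ℂ²`. -/
theorem continuous_modelInt (y₀ y₁ : Fin 3 → ℂ) (c : ℝ) : Continuous (modelInt y₀ y₁ c) := by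
  unfold modelInt
  have h0 := (continuous_slotLin y₀).norm
  have h1 := (continuous_slotLin y₁).norm
  exact ((h0.pow 2).mul (h1.pow 2)).mul
    (Real.continuous_exp.comp (continuous_const.mul ((h0.pow 2).add (h1.pow 2))).neg)

/-- The Gaussian `e^{−c ‖v‖²}` is integrable on `ℂ`. -/
theorem integrable_gauss_complex {c : ℝ} (hc : 0 < c) :
    Integrable (fun v : ℂ => Real.exp (-(c * ‖v‖ ^ 2))) := by
  have h := GaussianFourier.integrable_cexp_neg_mul_sq_norm_add (V := ℂ) (b := (c : ℂ)) (by simpa using hc) 0 0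
  refine h.norm.congr (Filter.Eventually.of_forall fun v => ?_)
  show ‖Complex.exp (-(c : ℂ) * ((‖v‖ : ℝ) : ℂ) ^ 2 + 0 * ((inner ℝ (0 : ℂ) v : ℝ) : ℂ))‖ = Real.exp (-(c * ‖v‖ ^ 2))
  rw [Complex.norm_exp, ← Complex.ofReal_pow]
  congr 1
  rw [show (-(c : ℂ) * ((‖v‖ ^ 2 : ℝ) : ℂ) + 0 * ((inner ℝ (0 : ℂ) v : ℝ) : ℂ)) = ((-(c * ‖v‖ ^ 2) : ℝ) : ℂ) by
    push_cast; ring, Complex.ofReal_re]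

/-- The Gaussian `e^{−c (‖v₀‖² + ‖v₁‖²)}` is integrable on `ℂ²`. -/
theorem integrable_gauss_two {c : ℝ} (hc : 0 < c) :
    Integrable (fun v : Fin 2 → ℂ => Real.exp (-(c * (‖v 0‖ ^ 2 + ‖v 1‖ ^ 2)))) := by
  have h := Integrable.fintype_prod (ι := Fin 2) (E := ℂ) (μ := fun _ => volume)
    (f := fun _ v => Real.exp (-(c * ‖v‖ ^ 2))) (fun _ => integrable_gauss_complex hc)
  rw [← volume_pi] at h
  refine h.congr (Filter.Eventually.of_forall fun v => ?_)
  simp only [Fin.prod_univ_two]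
  rw [← Real.exp_add]
  congr 1
  ring

/-- `t² e^{−ct} ≤ (8/c²) e^{−ct/2}` for `t ≥ 0`, `c > 0` (the quadratic Taylor term of `exp`). -/
theorem sq_mul_exp_neg_le {c t : ℝ} (hc : 0 < c) (ht : 0 ≤ t) :
    t ^ 2 * Real.exp (-(c * t)) ≤ 8 / c ^ 2 * Real.exp (-(c * t / 2)) := by
  have := Real.pow_div_factorial_le_exp (c * t / 2) (by positivity) 2
  have h2 : Real.exp (-(c * t)) = Real.exp (-(c * t / 2)) * Real.exp (-(c * t / 2)) := by
    rw [← Real.exp_add]; congr 1; ring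
  have h3 : Real.exp (c * t / 2) * Real.exp (-(c * t / 2)) = 1 := by rw [← Real.exp_add]; simp
  rw [h2]
  simp only [Nat.factorial_two, Nat.cast_ofNat] at this
  have h4 : t ^ 2 ≤ 8 / c ^ 2 * Real.exp (c * t / 2) := by
    rw [div_mul_eq_mul_div, le_div_iff₀ (by positivity)]
    nlinarith [this]
  calc t ^ 2 * (Real.exp (-(c * t / 2)) * Real.exp (-(c * t / 2)))
      ≤ 8 / c ^ 2 * Real.exp (c * t / 2) * (Real.exp (-(c * t / 2)) * Real.exp (-(c * t / 2))) :=
        mul_le_mul_of_nonneg_right h4 (by positivity)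
    _ = 8 / c ^ 2 * Real.exp (-(c * t / 2)) := by
        rw [mul_assoc, ← mul_assoc (Real.exp (c * t / 2)), h3, one_mul]

/-- `N = Σ ‖y_ij‖² > 0` when `Δ ≠ 0`. -/
theorem entries_sq_pos (y₀ y₁ : Fin 3 → ℂ) (hab : y₀ 0 * y₁ 1 - y₀ 1 * y₁ 0 ≠ 0) :
    0 < ‖y₀ 0‖ ^ 2 + ‖y₀ 1‖ ^ 2 + ‖y₁ 0‖ ^ 2 + ‖y₁ 1‖ ^ 2 := by
  rcases lt_or_ge 0 (‖y₀ 0‖ ^ 2 + ‖y₀ 1‖ ^ 2 + ‖y₁ 0‖ ^ 2 + ‖y₁ 1‖ ^ 2) with h | h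
  · exact h
  exfalso
  have a := sq_nonneg ‖y₀ 0‖
  have b := sq_nonneg ‖y₀ 1‖
  have c := sq_nonneg ‖y₁ 0‖
  have d := sq_nonneg ‖y₁ 1‖
  have h00 : y₀ 0 = 0 := by rw [← norm_eq_zero]; nlinarith
  have h11 : y₁ 1 = 0 := by rw [← norm_eq_zero]; nlinarith
  apply hab
  rw [h00, h11]
  have h01 : y₀ 1 = 0 := by rw [← norm_eq_zero]; nlinarith
  rw [h01]
  ring

/-- Coercivity of the linear part: `σ² (‖w₀‖² + ‖w₁‖²) ≤ ‖ℓ₀(w)‖² + ‖ℓ₁(w)‖²` with `σ² = ‖Δ‖² / (4N)`. -/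
theorem coercive_slotLin (y₀ y₁ : Fin 3 → ℂ) (hab : y₀ 0 * y₁ 1 - y₀ 1 * y₁ 0 ≠ 0) (w : Fin 2 → ℂ) :
    ‖y₀ 0 * y₁ 1 - y₀ 1 * y₁ 0‖ ^ 2 / (4 * (‖y₀ 0‖ ^ 2 + ‖y₀ 1‖ ^ 2 + ‖y₁ 0‖ ^ 2 + ‖y₁ 1‖ ^ 2)) *
      (‖w 0‖ ^ 2 + ‖w 1‖ ^ 2) ≤ ‖slotLin y₀ w‖ ^ 2 + ‖slotLin y₁ w‖ ^ 2 := by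
  have hN := entries_sq_pos y₀ y₁ hab
  rw [div_mul_eq_mul_div, div_le_iff₀ (by positivity)]
  have := sq_le_slotLin_sq y₀ y₁ w
  linarith

/-- The model integrand is dominated by a Gaussian. -/
theorem modelInt_le_gauss (y₀ y₁ : Fin 3 → ℂ) (hab : y₀ 0 * y₁ 1 - y₀ 1 * y₁ 0 ≠ 0) {c : ℝ} (hc : 0 < c)
    (w : Fin 2 → ℂ) :
    modelInt y₀ y₁ c w ≤ 2 / c ^ 2 * Real.exp (-(c * (‖y₀ 0 * y₁ 1 - y₀ 1 * y₁ 0‖ ^ 2 /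
      (4 * (‖y₀ 0‖ ^ 2 + ‖y₀ 1‖ ^ 2 + ‖y₁ 0‖ ^ 2 + ‖y₁ 1‖ ^ 2))) / 2 * (‖w 0‖ ^ 2 + ‖w 1‖ ^ 2))) := by
  unfold modelInt
  have hE : 0 ≤ ‖slotLin y₀ w‖ ^ 2 + ‖slotLin y₁ w‖ ^ 2 := by positivity
  have hQ : ‖slotLin y₀ w‖ ^ 2 * ‖slotLin y₁ w‖ ^ 2 ≤ (‖slotLin y₀ w‖ ^ 2 + ‖slotLin y₁ w‖ ^ 2) ^ 2 / 4 := by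
    nlinarith [sq_nonneg (‖slotLin y₀ w‖ ^ 2 - ‖slotLin y₁ w‖ ^ 2)]
  have hco := coercive_slotLin y₀ y₁ hab w
  calc ‖slotLin y₀ w‖ ^ 2 * ‖slotLin y₁ w‖ ^ 2 * Real.exp (-(c * (‖slotLin y₀ w‖ ^ 2 + ‖slotLin y₁ w‖ ^ 2)))
      ≤ (‖slotLin y₀ w‖ ^ 2 + ‖slotLin y₁ w‖ ^ 2) ^ 2 / 4 *
          Real.exp (-(c * (‖slotLin y₀ w‖ ^ 2 + ‖slotLin y₁ w‖ ^ 2))) :=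
        mul_le_mul_of_nonneg_right hQ (Real.exp_pos _).le
    _ = (1 / 4) * ((‖slotLin y₀ w‖ ^ 2 + ‖slotLin y₁ w‖ ^ 2) ^ 2 *
          Real.exp (-(c * (‖slotLin y₀ w‖ ^ 2 + ‖slotLin y₁ w‖ ^ 2)))) := by ring
    _ ≤ (1 / 4) * (8 / c ^ 2 * Real.exp (-(c * (‖slotLin y₀ w‖ ^ 2 + ‖slotLin y₁ w‖ ^ 2) / 2))) :=
        mul_le_mul_of_nonneg_left (sq_mul_exp_neg_le hc hE) (by norm_num)
    _ = 2 / c ^ 2 * Real.exp (-(c * (‖slotLin y₀ w‖ ^ 2 + ‖slotLin y₁ w‖ ^ 2) / 2)) := by ring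
    _ ≤ _ := by
        refine mul_le_mul_of_nonneg_left (Real.exp_le_exp.2 ?_) (by positivity)
        nlinarith [hco]

/-- The model integrand is integrable on `ℂ²`. -/
theorem integrable_modelInt (y₀ y₁ : Fin 3 → ℂ) (hab : y₀ 0 * y₁ 1 - y₀ 1 * y₁ 0 ≠ 0) {c : ℝ} (hc : 0 < c) :
    Integrable (modelInt y₀ y₁ c) := by
  have hN := entries_sq_pos y₀ y₁ hab
  have hΔ : 0 < ‖y₀ 0 * y₁ 1 - y₀ 1 * y₁ 0‖ := norm_pos_iff.2 hab
  have hg := (integrable_gauss_two (c := c * (‖y₀ 0 * y₁ 1 - y₀ 1 * y₁ 0‖ ^ 2 /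
      (4 * (‖y₀ 0‖ ^ 2 + ‖y₀ 1‖ ^ 2 + ‖y₁ 0‖ ^ 2 + ‖y₁ 1‖ ^ 2))) / 2) (by positivity)).const_mul (2 / c ^ 2)
  refine hg.mono' (continuous_modelInt y₀ y₁ c).aestronglyMeasurable (Filter.Eventually.of_forall fun w => ?_)
  rw [Real.norm_eq_abs, abs_of_nonneg (modelInt_nonneg y₀ y₁ c w)]
  exact modelInt_le_gauss y₀ y₁ hab hc w

/-- The model integral over any ball `B(0, r)`, `r > 0`, is positive. -/
theorem setIntegral_modelInt_pos (y₀ y₁ : Fin 3 → ℂ) (hab : y₀ 0 * y₁ 1 - y₀ 1 * y₁ 0 ≠ 0) {c : ℝ} (hc : 0 < c)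
    {r : ℝ} (hr : 0 < r) : 0 < ∫ v in Metric.ball (0 : Fin 2 → ℂ) r, modelInt y₀ y₁ c v := by
  have hint : IntegrableOn (modelInt y₀ y₁ c) (Metric.ball (0 : Fin 2 → ℂ) r) :=
    (integrable_modelInt y₀ y₁ hab hc).integrableOn
  rw [setIntegral_pos_iff_support_of_nonneg_ae (Filter.Eventually.of_forall (modelInt_nonneg y₀ y₁ c)) hint]
  -- a base point where both linear forms equal `1`
  set b₀ : Fin 2 → ℂ := ![conj ((y₁ 1 - y₀ 1) / (y₀ 0 * y₁ 1 - y₀ 1 * y₁ 0)),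
    conj ((y₀ 0 - y₁ 0) / (y₀ 0 * y₁ 1 - y₀ 1 * y₁ 0))] with hb₀
  have hA := div_mul_cancel₀ (y₁ 1 - y₀ 1) hab
  have hB := div_mul_cancel₀ (y₀ 0 - y₁ 0) hab
  have hb0 : slotLin y₀ b₀ = 1 := by
    apply mul_right_cancel₀ hab
    simp only [slotLin, hb₀, Matrix.cons_val_zero, Matrix.cons_val_one, Complex.conj_conj]
    linear_combination y₀ 0 * hA + y₀ 1 * hB
  have hb1 : slotLin y₁ b₀ = 1 := by
    apply mul_right_cancel₀ hab
    simp only [slotLin, hb₀, Matrix.cons_val_zero, Matrix.cons_val_one, Complex.conj_conj]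
    linear_combination y₁ 0 * hA + y₁ 1 * hB
  set t : ℝ := r / (2 * (‖b₀‖ + 1)) with ht
  have htpos : 0 < t := by positivity
  have hv₀ : t • b₀ ∈ Metric.ball (0 : Fin 2 → ℂ) r := by
    rw [mem_ball_zero_iff, norm_smul, Real.norm_eq_abs, abs_of_pos htpos, ht]
    have hb : 0 ≤ ‖b₀‖ := norm_nonneg _
    rw [div_mul_eq_mul_div, div_lt_iff₀ (by positivity)]
    nlinarith
  have hpos : 0 < modelInt y₀ y₁ c (t • b₀) := by
    unfold modelInt
    rw [slotLin_real_smul, slotLin_real_smul, hb0, hb1, mul_one, Complex.norm_real, Real.norm_eq_abs, abs_of_pos htpos]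
    positivity
  have hU : IsOpen ({v | 0 < modelInt y₀ y₁ c v} ∩ Metric.ball (0 : Fin 2 → ℂ) r) :=
    (isOpen_lt continuous_const (continuous_modelInt y₀ y₁ c)).inter Metric.isOpen_ball
  have hne : ({v | 0 < modelInt y₀ y₁ c v} ∩ Metric.ball (0 : Fin 2 → ℂ) r).Nonempty := ⟨t • b₀, hpos, hv₀⟩
  calc (0 : ENNReal) < volume ({v | 0 < modelInt y₀ y₁ c v} ∩ Metric.ball (0 : Fin 2 → ℂ) r) :=
        hU.measure_pos volume hne
    _ ≤ volume (Function.support (modelInt y₀ y₁ c) ∩ Metric.ball (0 : Fin 2 → ℂ) r) :=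
        measure_mono fun v hv => ⟨ne_of_gt hv.1, hv.2⟩



end Summit.Ventures.HodgeRepro.Tier4.Line3

end
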